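import Summits.ValiantsHypothesis.ValiantsHypothesis.Theses.NewtonUnitEquations

/-!
# Crux `NewtonUnitEquations.DissociatedUniform` (stmt-ValiantsHypothesis-5905) — line `greedy-basis-shadow`
# (lead's RESHAPED skeleton, v2)

Lead: prover-line-stmt-ValiantsHypothesis-5905-0.  Line card: `Cruxes/DissociatedUniform/Lines/greedy-basis-shadow.md`.

## What changed against the planner's skeleton (v1) and why

v1 composed `A → B → C → D → crux` with the open stub `D = KBoxShadowBound` (poly greedy SHADOW of `k`-letter boxes),
which is strictly STRONGER than the crux (it bounds the greedy words of every linear functional, not only the survivor of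
`𝟙`).  v2 keeps the composition idea (generic exposure → greedy word → alphabet reduction to `k`-letter sub-boxes → bound on
`k`-letter boxes) but makes the open stub CRUX-EQUIVALENT:

* `D'' = KLetterFrame`: VERBATIM the crux with the alphabet size `t` instantiated to `k` (dissociated frames with `≤ k`
  letters per coordinate have Newton polygons with `≤ (k*m*k+2)^C` vertices).  `crux → D''` is the specialisation `t := k`
  (`kLetterFrame_of_dissociatedUniform`, proved here); `D'' → crux` is this file's composition.  So the open stub is now
  EQUIVALENT to the crux — the line cannot die of a counterexample that is not a crux counterexample.
  `KBoxShadowBound → D''` given A and B is recorded (`kLetterFrame_of_kBoxShadowBound`), so a proof of the old stub D still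
  closes the line.
* `C'' = CoveringFamily` replaces `C = AlphabetReduction`: the SAME letter lemma + order-cell count, but stated as an explicit
  covering family (`≤ (k*m*t+2)^c` admissible sub-boxes such that every greedy word of every generic direction lies in one of
  them) instead of a transfer of cardinality bounds between shadows — the cardinality bookkeeping moves into the glue.
* `B2 = CoeffFormula` (the dissociated expansion `coeff (pt a) F = ∑ i, col f a i`, `supp F ⊆ pt '' box`) is registered as a
  stub of its own: the glue needs coefficient VALUES to see that a vertex `pt a₀` of `Newt(F)` lies in the support of `F`
  restricted to the sub-box containing the greedy word `a₀` (`restrictFrame`), whose support is inside `supp F`, so the vertex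
  stays a vertex there (`mem_extremePoints_convexHull_mono`).  Stub B (`TopSurvivorGreedy`) stays registered and is used.
* Stub A unchanged; stub C (`AlphabetReduction`) stays registered (a worker is on it) and feeds the recorded v1 chain
  `dissociatedUniform_of_v1 : A → B → C → KBoxShadowBound → crux`.

`dissociatedUniform_of_parts' : A → B → B2 → C'' → D'' → (crux unfolded)` is sorry-free; `DissociatedUniform_of` is the
ONLY theorem concluding the route decl by name.
-/

noncomputable section

open scoped BigOperators

namespace Summit.ValiantsHypothesis.ValiantsHypothesis.Cruxes.DissociatedUniform.GreedyBasisShadow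

set_option linter.dupNamespace false
set_option linter.unusedVariables false
set_option linter.style.longLine false

/-! ## §0 Objects of the line -/

/-- The planar point (total exponent) of a word `a ∈ ∏ j, A j`: `pt a = ∑ j, a j`. -/
def pt {m : ℕ} (a : Fin m → (Fin 2 →₀ ℕ)) : Fin 2 →₀ ℕ := ∑ j, a j

/-- The crux's embedding `ℕ² → ℝ²` (verbatim the lambda of the route decl). -/
def emb (e : Fin 2 →₀ ℕ) : Fin 2 → ℝ := fun i : Fin 2 => ((e i : ℕ) : ℝ)

/-- Height of an exponent in direction `w`: `⟪w, e⟫ = ∑ i, w i * e i`. -/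
def height (w : Fin 2 → ℝ) (e : Fin 2 →₀ ℕ) : ℝ := ∑ i, w i * ((e i : ℕ) : ℝ)

/-- Khatri–Rao column of a word: `(col f a) i = ∏ j, coeff (a j) (f i j)`. -/
def col {k m : ℕ} (f : Fin k → Fin m → MvPolynomial (Fin 2) ℂ) (a : Fin m → (Fin 2 →₀ ℕ)) : Fin k → ℂ :=
  fun i => ∏ j, (f i j).coeff (a j)

/-- Tensor value of a word: `tval f a = ∑ i, col f a i = ⟪𝟙, col f a⟫` (= `coeff (pt a) (∑ i, ∏ j, f i j)` on a dissociated
frame, stub B2). -/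
def tval {k m : ℕ} (f : Fin k → Fin m → MvPolynomial (Fin 2) ℂ) (a : Fin m → (Fin 2 →₀ ℕ)) : ℂ := ∑ i, col f a i

/-- Dissociated frame: the sum map is injective on `∏ j, A j` (verbatim the crux's third hypothesis). -/
def Dissociated {m : ℕ} (A : Fin m → Finset (Fin 2 →₀ ℕ)) : Prop :=
  ∀ a b : Fin m → (Fin 2 →₀ ℕ), (∀ j, a j ∈ A j) → (∀ j, b j ∈ A j) → ∑ j, a j = ∑ j, b j → a = b

/-- Generic direction for the frame `A`: heights separate the words of `∏ j, A j`. -/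
def IsGeneric {m : ℕ} (A : Fin m → Finset (Fin 2 →₀ ℕ)) (w : Fin 2 → ℝ) : Prop :=
  ∀ a ∈ Fintype.piFinset A, ∀ b ∈ Fintype.piFinset A, height w (pt a) = height w (pt b) → a = b

/-- The greedy (lex-first from the top) basis words of the Khatri–Rao column matroid in direction `w`. -/
def greedy {k m : ℕ} (A : Fin m → Finset (Fin 2 →₀ ℕ)) (f : Fin k → Fin m → MvPolynomial (Fin 2) ℂ)
    (w : Fin 2 → ℝ) : Set (Fin m → (Fin 2 →₀ ℕ)) :=
  {a | a ∈ Fintype.piFinset A ∧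
    col f a ∉ Submodule.span ℂ (col f '' {b | b ∈ Fintype.piFinset A ∧ height w (pt a) < height w (pt b)})}

/-- The greedy SHADOW of the frame: words that are greedy in SOME generic direction. -/
def shadow {k m : ℕ} (A : Fin m → Finset (Fin 2 →₀ ℕ)) (f : Fin k → Fin m → MvPolynomial (Fin 2) ℂ) :
    Set (Fin m → (Fin 2 →₀ ℕ)) :=
  {a | a ∈ Fintype.piFinset A ∧ ∃ w : Fin 2 → ℝ, IsGeneric A w ∧ a ∈ greedy A f w}

/-- The number of vertices of the Newton polygon of `F` (verbatim the crux's count). -/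
def nvert (F : MvPolynomial (Fin 2) ℂ) : ℕ :=
  (Set.extremePoints ℝ (convexHull ℝ (emb '' (F.support : Set (Fin 2 →₀ ℕ))))).ncard

/-- Restriction of a polynomial to the monomials of `S`: `∑_{ℓ ∈ S} coeff ℓ p • X^ℓ`. -/
def restrictTo (S : Finset (Fin 2 →₀ ℕ)) (p : MvPolynomial (Fin 2) ℂ) : MvPolynomial (Fin 2) ℂ :=
  ∑ l ∈ S, MvPolynomial.monomial l (p.coeff l)

/-! ## §1 Statements (readable forms; the registered stubs of §2 are their `δ`-unfoldings) -/

/-- **Stub A — exposed generic direction** (unchanged from v1). -/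
def ExposedGenericDirection : Prop :=
  ∀ (S T : Finset (Fin 2 →₀ ℕ)) (e : Fin 2 → ℝ),
    e ∈ Set.extremePoints ℝ (convexHull ℝ (emb '' (S : Set (Fin 2 →₀ ℕ)))) →
    ∃ (w : Fin 2 → ℝ) (e₀ : Fin 2 →₀ ℕ), e₀ ∈ S ∧ emb e₀ = e ∧
      (∀ s ∈ S, s ≠ e₀ → height w s < height w e₀) ∧
      Set.InjOn (height w) (T : Set (Fin 2 →₀ ℕ))

/-- **Stub B — the greedy-word lemma** (unchanged from v1). -/
def TopSurvivorGreedy : Prop :=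
  ∀ (k m : ℕ) (A : Fin m → Finset (Fin 2 →₀ ℕ)) (f : Fin k → Fin m → MvPolynomial (Fin 2) ℂ)
    (w : Fin 2 → ℝ) (e₀ : Fin 2 →₀ ℕ),
    (∀ i j, (f i j).support ⊆ A j) → Dissociated A →
    e₀ ∈ (∑ i, ∏ j, f i j).support →
    (∀ s ∈ (∑ i, ∏ j, f i j).support, s ≠ e₀ → height w s < height w e₀) →
    ∃ a₀ ∈ Fintype.piFinset A, pt a₀ = e₀ ∧ a₀ ∈ greedy A f w

/-- **Stub B2 — the dissociated expansion (coefficient formula).**  On a dissociated frame (`supp (f i j) ⊆ A j`, sum map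
injective on the box) `F = ∑ i, ∏ j, f i j = ∑_{a ∈ box} tval f a • X^(pt a)` with pairwise distinct monomials, hence
`coeff (pt a) F = tval f a` for every word and `supp F ⊆ pt '' box`.  (`MvPolynomial.as_sum`, `Finset.prod_univ_sum`,
`monomial` products, `coeff_sum`, `coeff_monomial`, dissociation.)  Size S/M. -/
def CoeffFormula : Prop :=
  ∀ (k m : ℕ) (A : Fin m → Finset (Fin 2 →₀ ℕ)) (f : Fin k → Fin m → MvPolynomial (Fin 2) ℂ),
    (∀ i j, (f i j).support ⊆ A j) → Dissociated A →
    (∀ a ∈ Fintype.piFinset A, (∑ i, ∏ j, f i j).coeff (pt a) = tval f a) ∧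
    ∀ e ∈ (∑ i, ∏ j, f i j).support, ∃ a ∈ Fintype.piFinset A, pt a = e

/-- **Stub C (v1) — alphabet reduction as a transfer of shadow bounds** (kept registered: a worker is proving it; together
with `KBoxShadowBound` it gives the v1 composition `dissociatedUniform_of_v1`). -/
def AlphabetReduction : Prop :=
  ∃ c : ℕ, ∀ (k m t : ℕ) (A : Fin m → Finset (Fin 2 →₀ ℕ)) (f : Fin k → Fin m → MvPolynomial (Fin 2) ℂ),
    (∀ j, (A j).card ≤ t) → Dissociated A →
    ∀ N : ℕ,
      (∀ B : Fin m → Finset (Fin 2 →₀ ℕ), (∀ j, B j ⊆ A j) → (∀ j, (B j).card ≤ k) →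
        (shadow B f).ncard ≤ N) →
      (shadow A f).ncard ≤ (k * m * t + 2) ^ c * N

/-- **Stub C'' — the covering family (alphabet reduction, covering form; TRUE on paper: letter lemma + `≤ k` independent
letters + letter-order cells).**  There are `≤ (k*m*t+2)^c` sub-boxes `B ≤ A` with `≤ k` letters per coordinate such that
for every generic direction `w` every greedy word of `A` lies in (the word box of) one of them.  Proof: for generic `w`
letters of each `A j` have distinct heights; `a ∈ greedy A f w ⇒ a j ∈ g_j(w)` (greedy basis of the letter columns
`ℓ ↦ (coeff ℓ (f i j))_i` in height order: Hadamard-multiply a dependence on higher letters by the other coordinates'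
coefficients); `|g_j(w)| ≤ k` (lex-first bases are linearly independent in `ℂ^k`); `g_j(w)` depends on `w` only through the
strict height order on `A j`, i.e. through the sign vector of `≤ m t²` linear forms, which takes `≤ 4 m t² + 6` values over
generic `w` (charts `w = (±1, λ)`, `(0, ±1)`; along a chart the set of forms whose sign differs from the sign at a base point
is monotone in `λ`, a chain of subsets).  Degenerate cases: `k = 0` ⇒ no greedy words (`𝔅 = ∅` works); all `|A j| ≤ k` ⇒
`𝔅 = {A}`. -/
def CoveringFamily : Prop :=
  ∃ c : ℕ, ∀ (k m t : ℕ) (A : Fin m → Finset (Fin 2 →₀ ℕ)) (f : Fin k → Fin m → MvPolynomial (Fin 2) ℂ),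
    (∀ j, (A j).card ≤ t) → Dissociated A →
    ∃ 𝔅 : Finset (Fin m → Finset (Fin 2 →₀ ℕ)), 𝔅.card ≤ (k * m * t + 2) ^ c ∧
      (∀ B ∈ 𝔅, (∀ j, B j ⊆ A j) ∧ ∀ j, (B j).card ≤ k) ∧
      ∀ w : Fin 2 → ℝ, IsGeneric A w → ∀ a ∈ greedy A f w, ∃ B ∈ 𝔅, a ∈ Fintype.piFinset B

/-- **Stub D'' — the crux ON `k`-LETTER FRAMES (OPEN; crux-equivalent).**  Verbatim the crux `DissociatedUniform` with the
alphabet-size parameter `t` instantiated to `k`: a dissociated frame with `≤ k` letters per coordinate carries Newton polygons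
with `≤ (k*m*k+2)^C` vertices.  `DissociatedUniform → KLetterFrame` is the specialisation `t := k`
(`kLetterFrame_of_dissociatedUniform`); `KLetterFrame → DissociatedUniform` is this file.  Everything known about the crux
applies verbatim (character designs = Conjecture K level sets; generic tensors = top-`k` words; Theorem Q's machinery gives
`k^{O(log m)}·poly`; the lead's exact level-set computations — all linear — are attached to the item as `D-compute-c1.md`). -/
def KLetterFrame : Prop :=
  ∃ C : ℕ, ∀ (k m : ℕ) (A : Fin m → Finset (Fin 2 →₀ ℕ)) (f : Fin k → Fin m → MvPolynomial (Fin 2) ℂ),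
    (∀ j, (A j).card ≤ k) → (∀ i j, (f i j).support ⊆ A j) → Dissociated A →
    nvert (∑ i, ∏ j, f i j) ≤ (k * m * k + 2) ^ C

/-- The v1 open stub (for the record): poly greedy shadow of `k`-letter boxes.  Implies `KLetterFrame` given stubs A and B2
(`kLetterFrame_of_kBoxShadowBound`). -/
def KBoxShadowBound : Prop :=
  ∃ C : ℕ, ∀ (k m : ℕ) (B : Fin m → Finset (Fin 2 →₀ ℕ)) (f : Fin k → Fin m → MvPolynomial (Fin 2) ℂ),
    (∀ j, (B j).card ≤ k) → Dissociated B → (shadow B f).ncard ≤ (k * m + 2) ^ C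

/-! ## §2 The registered stubs (DEF-FREE signatures; `sorry` lives only here) -/

/-- Registered stub A = `ExposedGenericDirection` unfolded (planar convex geometry, size M). -/
theorem stub_exposedGenericDirection (S T : Finset (Fin 2 →₀ ℕ)) (e : Fin 2 → ℝ)
    (he : e ∈ Set.extremePoints ℝ
      (convexHull ℝ ((fun e : Fin 2 →₀ ℕ => fun i : Fin 2 => ((e i : ℕ) : ℝ)) '' (S : Set (Fin 2 →₀ ℕ))))) :
    ∃ (w : Fin 2 → ℝ) (e₀ : Fin 2 →₀ ℕ), e₀ ∈ S ∧ (fun i : Fin 2 => ((e₀ i : ℕ) : ℝ)) = e ∧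
      (∀ s ∈ S, s ≠ e₀ → (∑ i, w i * ((s i : ℕ) : ℝ)) < ∑ i, w i * ((e₀ i : ℕ) : ℝ)) ∧
      Set.InjOn (fun e : Fin 2 →₀ ℕ => ∑ i, w i * ((e i : ℕ) : ℝ)) (T : Set (Fin 2 →₀ ℕ)) := by
  sorry

/-- Registered stub B = `TopSurvivorGreedy` unfolded (greedy-word lemma, size M). -/
theorem stub_topSurvivorGreedy (k m : ℕ) (A : Fin m → Finset (Fin 2 →₀ ℕ))
    (f : Fin k → Fin m → MvPolynomial (Fin 2) ℂ) (w : Fin 2 → ℝ) (e₀ : Fin 2 →₀ ℕ)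
    (hsupp : ∀ i j, (f i j).support ⊆ A j)
    (hdis : ∀ a b : Fin m → (Fin 2 →₀ ℕ), (∀ j, a j ∈ A j) → (∀ j, b j ∈ A j) → ∑ j, a j = ∑ j, b j → a = b)
    (he₀ : e₀ ∈ (∑ i, ∏ j, f i j).support)
    (hmax : ∀ s ∈ (∑ i, ∏ j, f i j).support, s ≠ e₀ →
      (∑ i, w i * ((s i : ℕ) : ℝ)) < ∑ i, w i * ((e₀ i : ℕ) : ℝ)) :
    ∃ a₀ ∈ Fintype.piFinset A, ∑ j, a₀ j = e₀ ∧
      a₀ ∈ {a : Fin m → (Fin 2 →₀ ℕ) | a ∈ Fintype.piFinset A ∧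
          (fun i => ∏ j, (f i j).coeff (a j)) ∉ Submodule.span ℂ
            ((fun b : Fin m → (Fin 2 →₀ ℕ) => fun i => ∏ j, (f i j).coeff (b j)) ''
              {b | b ∈ Fintype.piFinset A ∧
                (∑ i, w i * (((∑ j, a j) i : ℕ) : ℝ)) < ∑ i, w i * (((∑ j, b j) i : ℕ) : ℝ)})} := by
  sorry

/-- Registered stub B2 = `CoeffFormula` unfolded (dissociated expansion, size S/M). -/
theorem stub_coeffFormula (k m : ℕ) (A : Fin m → Finset (Fin 2 →₀ ℕ))
    (f : Fin k → Fin m → MvPolynomial (Fin 2) ℂ)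
    (hsupp : ∀ i j, (f i j).support ⊆ A j)
    (hdis : ∀ a b : Fin m → (Fin 2 →₀ ℕ), (∀ j, a j ∈ A j) → (∀ j, b j ∈ A j) → ∑ j, a j = ∑ j, b j → a = b) :
    (∀ a ∈ Fintype.piFinset A, (∑ i, ∏ j, f i j).coeff (∑ j, a j) = ∑ i, ∏ j, (f i j).coeff (a j)) ∧
    ∀ e ∈ (∑ i, ∏ j, f i j).support, ∃ a ∈ Fintype.piFinset A, ∑ j, a j = e := by
  sorry

/-- Registered stub C (v1) = `AlphabetReduction` unfolded (letter lemma + restriction lemma + order cells, size L). -/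
theorem stub_alphabetReduction :
    ∃ c : ℕ, ∀ (k m t : ℕ) (A : Fin m → Finset (Fin 2 →₀ ℕ)) (f : Fin k → Fin m → MvPolynomial (Fin 2) ℂ),
      (∀ j, (A j).card ≤ t) →
      (∀ a b : Fin m → (Fin 2 →₀ ℕ), (∀ j, a j ∈ A j) → (∀ j, b j ∈ A j) → ∑ j, a j = ∑ j, b j → a = b) →
      ∀ N : ℕ,
        (∀ B : Fin m → Finset (Fin 2 →₀ ℕ), (∀ j, B j ⊆ A j) → (∀ j, (B j).card ≤ k) →
          {a : Fin m → (Fin 2 →₀ ℕ) | a ∈ Fintype.piFinset B ∧ ∃ w : Fin 2 → ℝ,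
            (∀ a ∈ Fintype.piFinset B, ∀ b ∈ Fintype.piFinset B,
              (∑ i, w i * (((∑ j, a j) i : ℕ) : ℝ)) = (∑ i, w i * (((∑ j, b j) i : ℕ) : ℝ)) → a = b) ∧
            a ∈ {a : Fin m → (Fin 2 →₀ ℕ) | a ∈ Fintype.piFinset B ∧
                (fun i => ∏ j, (f i j).coeff (a j)) ∉ Submodule.span ℂ
                  ((fun b : Fin m → (Fin 2 →₀ ℕ) => fun i => ∏ j, (f i j).coeff (b j)) ''
                    {b | b ∈ Fintype.piFinset B ∧
                      (∑ i, w i * (((∑ j, a j) i : ℕ) : ℝ)) < ∑ i, w i * (((∑ j, b j) i : ℕ) : ℝ)})}}.ncard ≤ N) →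
        {a : Fin m → (Fin 2 →₀ ℕ) | a ∈ Fintype.piFinset A ∧ ∃ w : Fin 2 → ℝ,
          (∀ a ∈ Fintype.piFinset A, ∀ b ∈ Fintype.piFinset A,
            (∑ i, w i * (((∑ j, a j) i : ℕ) : ℝ)) = (∑ i, w i * (((∑ j, b j) i : ℕ) : ℝ)) → a = b) ∧
          a ∈ {a : Fin m → (Fin 2 →₀ ℕ) | a ∈ Fintype.piFinset A ∧
              (fun i => ∏ j, (f i j).coeff (a j)) ∉ Submodule.span ℂ
                ((fun b : Fin m → (Fin 2 →₀ ℕ) => fun i => ∏ j, (f i j).coeff (b j)) ''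
                  {b | b ∈ Fintype.piFinset A ∧
                    (∑ i, w i * (((∑ j, a j) i : ℕ) : ℝ)) < ∑ i, w i * (((∑ j, b j) i : ℕ) : ℝ)})}}.ncard ≤ (k * m * t + 2) ^ c * N := by
  sorry

/-- Registered stub C'' = `CoveringFamily` unfolded (letter lemma + independent letters + order cells, size L). -/
theorem stub_coveringFamily :
    ∃ c : ℕ, ∀ (k m t : ℕ) (A : Fin m → Finset (Fin 2 →₀ ℕ)) (f : Fin k → Fin m → MvPolynomial (Fin 2) ℂ),
      (∀ j, (A j).card ≤ t) →
      (∀ a b : Fin m → (Fin 2 →₀ ℕ), (∀ j, a j ∈ A j) → (∀ j, b j ∈ A j) → ∑ j, a j = ∑ j, b j → a = b) →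
      ∃ 𝔅 : Finset (Fin m → Finset (Fin 2 →₀ ℕ)), 𝔅.card ≤ (k * m * t + 2) ^ c ∧
        (∀ B ∈ 𝔅, (∀ j, B j ⊆ A j) ∧ ∀ j, (B j).card ≤ k) ∧
        ∀ w : Fin 2 → ℝ,
          (∀ a ∈ Fintype.piFinset A, ∀ b ∈ Fintype.piFinset A,
            (∑ i, w i * (((∑ j, a j) i : ℕ) : ℝ)) = (∑ i, w i * (((∑ j, b j) i : ℕ) : ℝ)) → a = b) →
          ∀ a ∈ {a : Fin m → (Fin 2 →₀ ℕ) | a ∈ Fintype.piFinset A ∧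
              (fun i => ∏ j, (f i j).coeff (a j)) ∉ Submodule.span ℂ
                ((fun b : Fin m → (Fin 2 →₀ ℕ) => fun i => ∏ j, (f i j).coeff (b j)) ''
                  {b | b ∈ Fintype.piFinset A ∧
                    (∑ i, w i * (((∑ j, a j) i : ℕ) : ℝ)) < ∑ i, w i * (((∑ j, b j) i : ℕ) : ℝ)})},
            ∃ B ∈ 𝔅, a ∈ Fintype.piFinset B := by
  sorry

/-- Registered stub D'' = `KLetterFrame` unfolded: VERBATIM the crux `DissociatedUniform` at `t := k` (OPEN, hardest;
crux-equivalent). -/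
theorem stub_kLetterFrame :
    ∃ C : ℕ, ∀ (k m : ℕ) (A : Fin m → Finset (Fin 2 →₀ ℕ)) (f : Fin k → Fin m → MvPolynomial (Fin 2) ℂ),
      (∀ j, (A j).card ≤ k) → (∀ i j, (f i j).support ⊆ A j) →
      (∀ a b : Fin m → (Fin 2 →₀ ℕ), (∀ j, a j ∈ A j) → (∀ j, b j ∈ A j) → ∑ j, a j = ∑ j, b j → a = b) →
      (Set.extremePoints ℝ (convexHull ℝ ((fun e : Fin 2 →₀ ℕ => fun i : Fin 2 => ((e i : ℕ) : ℝ)) ''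
        ((∑ i, ∏ j, f i j).support : Set (Fin 2 →₀ ℕ))))).ncard ≤ (k * m * k + 2) ^ C := by
  sorry

/-! ## §3 Glue (sorry-free) -/

section Glue

variable {k m : ℕ}

theorem Dissociated.mono {A B : Fin m → Finset (Fin 2 →₀ ℕ)} (hA : Dissociated A) (hBA : ∀ j, B j ⊆ A j) :
    Dissociated B :=
  fun a b ha hb h => hA a b (fun j => hBA j (ha j)) (fun j => hBA j (hb j)) h

/-- Genericity for the frame follows from injectivity of the height on the finite sumset and dissociation. -/
theorem isGeneric_of_injOn {A : Fin m → Finset (Fin 2 →₀ ℕ)} (hA : Dissociated A) {w : Fin 2 → ℝ}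
    (h : Set.InjOn (height w)
      (((Fintype.piFinset A).image pt : Finset (Fin 2 →₀ ℕ)) : Set (Fin 2 →₀ ℕ))) :
    IsGeneric A w := by
  intro a ha b hb hab
  have hpa : pt a ∈ (Fintype.piFinset A).image pt := Finset.mem_image_of_mem _ ha
  have hpb : pt b ∈ (Fintype.piFinset A).image pt := Finset.mem_image_of_mem _ hb
  have hpt : pt a = pt b := h (Finset.mem_coe.mpr hpa) (Finset.mem_coe.mpr hpb) hab
  exact hA a b (Fintype.mem_piFinset.mp ha) (Fintype.mem_piFinset.mp hb) hpt

/-- The crux at `t := k` is a special case of the crux. -/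
theorem kLetterFrame_of_dissociatedUniform
    (h : Summit.ValiantsHypothesis.ValiantsHypothesis.Theses.NewtonUnitEquations.DissociatedUniform) : KLetterFrame := by
  obtain ⟨C, hC⟩ := h
  exact ⟨C, fun k m A f hcard hsupp hdis => hC k m k A f hcard hsupp hdis⟩

/-! ### Restriction of a frame to a sub-box -/

theorem coeff_restrictTo (S : Finset (Fin 2 →₀ ℕ)) (p : MvPolynomial (Fin 2) ℂ) (l : Fin 2 →₀ ℕ) :
    (restrictTo S p).coeff l = if l ∈ S then p.coeff l else 0 := by
  classical
  unfold restrictTo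
  rw [MvPolynomial.coeff_sum]
  simp only [MvPolynomial.coeff_monomial]
  rw [Finset.sum_ite_eq' S l (fun x => p.coeff x)]

theorem coeff_restrictTo_of_mem {S : Finset (Fin 2 →₀ ℕ)} (p : MvPolynomial (Fin 2) ℂ) {l : Fin 2 →₀ ℕ} (hl : l ∈ S) :
    (restrictTo S p).coeff l = p.coeff l := by
  rw [coeff_restrictTo, if_pos hl]

theorem support_restrictTo (S : Finset (Fin 2 →₀ ℕ)) (p : MvPolynomial (Fin 2) ℂ) : (restrictTo S p).support ⊆ S := by
  intro l hl
  by_contra h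
  rw [MvPolynomial.mem_support_iff, coeff_restrictTo, if_neg h] at hl
  exact hl rfl

/-- The restricted frame `f|_B i j = restrictTo (B j) (f i j)`. -/
def restrictFrame (B : Fin m → Finset (Fin 2 →₀ ℕ)) (f : Fin k → Fin m → MvPolynomial (Fin 2) ℂ) :
    Fin k → Fin m → MvPolynomial (Fin 2) ℂ :=
  fun i j => restrictTo (B j) (f i j)

theorem tval_restrictFrame {B : Fin m → Finset (Fin 2 →₀ ℕ)} (f : Fin k → Fin m → MvPolynomial (Fin 2) ℂ)
    {a : Fin m → (Fin 2 →₀ ℕ)} (ha : a ∈ Fintype.piFinset B) : tval (restrictFrame B f) a = tval f a := by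
  unfold tval col restrictFrame
  refine Finset.sum_congr rfl fun i _ => Finset.prod_congr rfl fun j _ => ?_
  exact coeff_restrictTo_of_mem _ (Fintype.mem_piFinset.mp ha j)

/-- On a dissociated frame, the support of the restricted sum of products is contained in the original support. -/
theorem support_restrict_subset (hB2 : CoeffFormula) {A B : Fin m → Finset (Fin 2 →₀ ℕ)}
    {f : Fin k → Fin m → MvPolynomial (Fin 2) ℂ} (hsupp : ∀ i j, (f i j).support ⊆ A j) (hdis : Dissociated A)
    (hBA : ∀ j, B j ⊆ A j) :
    (∑ i, ∏ j, restrictFrame B f i j).support ⊆ (∑ i, ∏ j, f i j).support := by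
  intro e he
  have hsuppB : ∀ i j, (restrictFrame B f i j).support ⊆ B j := fun i j => support_restrictTo _ _
  obtain ⟨hcoefB, hcovB⟩ := hB2 k m B (restrictFrame B f) hsuppB (hdis.mono hBA)
  obtain ⟨hcoefA, -⟩ := hB2 k m A f hsupp hdis
  obtain ⟨a, ha, rfl⟩ := hcovB e he
  have hne : tval f a ≠ 0 := by
    rw [← tval_restrictFrame f ha, ← hcoefB a ha]
    exact MvPolynomial.mem_support_iff.mp he
  rw [MvPolynomial.mem_support_iff, hcoefA a (Fintype.piFinset_subset _ _ hBA ha)]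
  exact hne

/-- A word of the sub-box with nonzero tensor value is in the support of the restricted polynomial. -/
theorem pt_mem_support_restrict (hB2 : CoeffFormula) {A B : Fin m → Finset (Fin 2 →₀ ℕ)}
    {f : Fin k → Fin m → MvPolynomial (Fin 2) ℂ} (hdis : Dissociated A) (hBA : ∀ j, B j ⊆ A j)
    {a : Fin m → (Fin 2 →₀ ℕ)} (ha : a ∈ Fintype.piFinset B) (hval : tval f a ≠ 0) :
    pt a ∈ (∑ i, ∏ j, restrictFrame B f i j).support := by
  have hsuppB : ∀ i j, (restrictFrame B f i j).support ⊆ B j := fun i j => support_restrictTo _ _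
  obtain ⟨hcoefB, -⟩ := hB2 k m B (restrictFrame B f) hsuppB (hdis.mono hBA)
  rw [MvPolynomial.mem_support_iff, hcoefB a ha, tval_restrictFrame f ha]
  exact hval

/-- Extreme points of the hull of a set stay extreme in the hull of any subset containing them. -/
theorem mem_extremePoints_convexHull_mono {E : Type*} [AddCommGroup E] [Module ℝ E] {S T : Set E} (hST : S ⊆ T)
    {e : E} (heS : e ∈ S) (he : e ∈ (convexHull ℝ T).extremePoints ℝ) : e ∈ (convexHull ℝ S).extremePoints ℝ := by
  rw [mem_extremePoints] at he ⊢
  refine ⟨subset_convexHull ℝ S heS, fun x₁ hx₁ x₂ hx₂ hx => ?_⟩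
  exact he.2 x₁ (convexHull_mono hST hx₁) x₂ (convexHull_mono hST hx₂) hx

/-- **L1''**: every vertex of the Newton polygon of `F` is a vertex of the Newton polygon of `F` restricted to some sub-box
of the covering family (stubs A + B + B2 + C''). -/
theorem extremePoints_subset_cover (hA : ExposedGenericDirection) (hB : TopSurvivorGreedy) (hB2 : CoeffFormula)
    {A : Fin m → Finset (Fin 2 →₀ ℕ)} {f : Fin k → Fin m → MvPolynomial (Fin 2) ℂ}
    (hsupp : ∀ i j, (f i j).support ⊆ A j) (hdis : Dissociated A)
    {𝔅 : Finset (Fin m → Finset (Fin 2 →₀ ℕ))} (h𝔅 : ∀ B ∈ 𝔅, (∀ j, B j ⊆ A j) ∧ ∀ j, (B j).card ≤ k)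
    (hcover : ∀ w : Fin 2 → ℝ, IsGeneric A w → ∀ a ∈ greedy A f w, ∃ B ∈ 𝔅, a ∈ Fintype.piFinset B) :
    Set.extremePoints ℝ (convexHull ℝ (emb '' ((∑ i, ∏ j, f i j).support : Set (Fin 2 →₀ ℕ))))
      ⊆ ⋃ B ∈ 𝔅, Set.extremePoints ℝ (convexHull ℝ (emb ''
          ((∑ i, ∏ j, restrictFrame B f i j).support : Set (Fin 2 →₀ ℕ)))) := by
  intro e he
  obtain ⟨w, e₀, he₀, hee, hmax, hinj⟩ :=
    hA (∑ i, ∏ j, f i j).support ((Fintype.piFinset A).image pt) _ he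
  have hgen : IsGeneric A w := isGeneric_of_injOn hdis hinj
  obtain ⟨a₀, ha₀, hpt, hgr⟩ := hB k m A f w e₀ hsupp hdis he₀ hmax
  obtain ⟨hcoef, -⟩ := hB2 k m A f hsupp hdis
  have hval : tval f a₀ ≠ 0 := by
    rw [← hcoef a₀ ha₀, hpt]
    exact MvPolynomial.mem_support_iff.mp he₀
  obtain ⟨B, hB𝔅, haB⟩ := hcover w hgen a₀ hgr
  have hBA := (h𝔅 B hB𝔅).1
  have hmemB : e₀ ∈ (∑ i, ∏ j, restrictFrame B f i j).support := by
    rw [← hpt]; exact pt_mem_support_restrict hB2 hdis hBA haB hval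
  refine Set.mem_iUnion₂.mpr ⟨B, hB𝔅, ?_⟩
  refine mem_extremePoints_convexHull_mono (Set.image_mono ?_) ⟨e₀, hmemB, hee⟩ he
  exact Finset.coe_subset.mpr (support_restrict_subset hB2 hsupp hdis hBA)

/-- Counting over the covering family. -/
theorem ncard_extremePoints_le_of_cover {C : ℕ}
    (hD : ∀ (k m : ℕ) (A : Fin m → Finset (Fin 2 →₀ ℕ)) (f : Fin k → Fin m → MvPolynomial (Fin 2) ℂ),
      (∀ j, (A j).card ≤ k) → (∀ i j, (f i j).support ⊆ A j) → Dissociated A →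
      nvert (∑ i, ∏ j, f i j) ≤ (k * m * k + 2) ^ C)
    {A : Fin m → Finset (Fin 2 →₀ ℕ)} {f : Fin k → Fin m → MvPolynomial (Fin 2) ℂ} (hdis : Dissociated A)
    {𝔅 : Finset (Fin m → Finset (Fin 2 →₀ ℕ))} (h𝔅 : ∀ B ∈ 𝔅, (∀ j, B j ⊆ A j) ∧ ∀ j, (B j).card ≤ k)
    {E : Set (Fin 2 → ℝ)}
    (hE : E ⊆ ⋃ B ∈ 𝔅, Set.extremePoints ℝ (convexHull ℝ (emb ''
          ((∑ i, ∏ j, restrictFrame B f i j).support : Set (Fin 2 →₀ ℕ))))) :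
    E.ncard ≤ 𝔅.card * (k * m * k + 2) ^ C := by
  classical
  set V : (Fin m → Finset (Fin 2 →₀ ℕ)) → Set (Fin 2 → ℝ) := fun B =>
    Set.extremePoints ℝ (convexHull ℝ (emb '' ((∑ i, ∏ j, restrictFrame B f i j).support : Set (Fin 2 →₀ ℕ)))) with hV
  have hfin : ∀ B ∈ 𝔅, (V B).Finite := fun B _ =>
    (Set.Finite.image emb (Finset.finite_toSet _)).subset extremePoints_convexHull_subset
  have hUfin : (⋃ B ∈ 𝔅, V B).Finite := Set.Finite.biUnion (Finset.finite_toSet 𝔅) hfin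
  calc E.ncard ≤ (⋃ B ∈ 𝔅, V B).ncard := Set.ncard_le_ncard hE hUfin
    _ ≤ ∑ B ∈ 𝔅, (V B).ncard := Finset.set_ncard_biUnion_le 𝔅 _
    _ ≤ ∑ B ∈ 𝔅, (k * m * k + 2) ^ C := by
        refine Finset.sum_le_sum fun B hB => ?_
        exact hD k m B (restrictFrame B f) (h𝔅 B hB).2 (fun i j => support_restrictTo _ _) (hdis.mono (h𝔅 B hB).1)
    _ = 𝔅.card * (k * m * k + 2) ^ C := by rw [Finset.sum_const, smul_eq_mul]

/-- `x^c * (x^2)^C = x^(2C+c)`. -/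
theorem pow_mul_pow_sq (x c C : ℕ) : x ^ c * (x ^ 2) ^ C = x ^ (2 * C + c) := by
  rw [← pow_mul, ← pow_add, Nat.add_comm]

/-- **The composition** `A → B → B2 → C'' → D'' →` the crux (unfolded verbatim).  Sorry-free. -/
theorem dissociatedUniform_of_parts' (hA : ExposedGenericDirection) (hB : TopSurvivorGreedy) (hB2 : CoeffFormula)
    (hC : CoveringFamily) (hD : KLetterFrame) :
    ∃ C : ℕ, ∀ (k m t : ℕ) (A : Fin m → Finset (Fin 2 →₀ ℕ)) (f : Fin k → Fin m → MvPolynomial (Fin 2) ℂ),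
      (∀ j, (A j).card ≤ t) → (∀ i j, (f i j).support ⊆ A j) →
      (∀ a b : Fin m → (Fin 2 →₀ ℕ), (∀ j, a j ∈ A j) → (∀ j, b j ∈ A j) → ∑ j, a j = ∑ j, b j → a = b) →
      (Set.extremePoints ℝ (convexHull ℝ ((fun e : Fin 2 →₀ ℕ => fun i : Fin 2 => ((e i : ℕ) : ℝ)) ''
        ((∑ i, ∏ j, f i j).support : Set (Fin 2 →₀ ℕ))))).ncard ≤ (k * m * t + 2) ^ C := by
  obtain ⟨c, hC⟩ := hC
  obtain ⟨C, hD⟩ := hD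
  refine ⟨2 * C + c, fun k m t A f hcard hsupp hinj => ?_⟩
  have hdis : Dissociated A := hinj
  obtain ⟨𝔅, h𝔅card, h𝔅adm, hcover⟩ := hC k m t A f hcard hdis
  have h1 := extremePoints_subset_cover hA hB hB2 hsupp hdis h𝔅adm hcover
  have h2 := ncard_extremePoints_le_of_cover hD hdis h𝔅adm h1
  change (Set.extremePoints ℝ (convexHull ℝ (emb ''
    ((∑ i, ∏ j, f i j).support : Set (Fin 2 →₀ ℕ))))).ncard ≤ (k * m * t + 2) ^ (2 * C + c)
  rcases Nat.eq_zero_or_pos t with rfl | ht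
  · rcases Nat.eq_zero_or_pos m with rfl | hm
    · calc _ ≤ 𝔅.card * (k * 0 * k + 2) ^ C := h2
        _ ≤ (k * 0 * 0 + 2) ^ c * (k * 0 * k + 2) ^ C := Nat.mul_le_mul_right _ h𝔅card
        _ ≤ (k * 0 * 0 + 2) ^ c * ((k * 0 * 0 + 2) ^ 2) ^ C :=
          Nat.mul_le_mul_left _ (Nat.pow_le_pow_left (by norm_num) C)
        _ = (k * 0 * 0 + 2) ^ (2 * C + c) := pow_mul_pow_sq _ _ _
    · -- `A ⟨0, hm⟩ = ∅`: no words, so the support is empty and there are no vertices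
      have hj : A ⟨0, hm⟩ = ∅ := Finset.card_eq_zero.mp (Nat.le_zero.mp (hcard ⟨0, hm⟩))
      have hbox : Fintype.piFinset A = ∅ := by
        apply Finset.eq_empty_of_forall_notMem
        intro a ha
        have := Fintype.mem_piFinset.mp ha ⟨0, hm⟩
        simp [hj] at this
      have hsupp0 : (∑ i, ∏ j, f i j).support = ∅ := by
        apply Finset.eq_empty_of_forall_notMem
        intro e he
        obtain ⟨a, ha, -⟩ := (hB2 k m A f hsupp hdis).2 e he
        simp [hbox] at ha
      have hE : Set.extremePoints ℝ (convexHull ℝ (emb ''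
          ((∑ i, ∏ j, f i j).support : Set (Fin 2 →₀ ℕ)))) = ∅ := by
        apply Set.subset_empty_iff.mp
        intro e he
        have := extremePoints_convexHull_subset he
        simp [hsupp0] at this
      rw [hE, Set.ncard_empty]
      exact Nat.zero_le _
  · have hkm : k * m * k + 2 ≤ (k * m * t + 2) ^ 2 := by
      rcases Nat.eq_zero_or_pos m with rfl | hm
      · norm_num
      · have h1' : k ≤ k * m * t :=
          calc k = k * 1 * 1 := by ring
            _ ≤ k * m * t := Nat.mul_le_mul (Nat.mul_le_mul_left k hm) ht
        have h2' : k * m ≤ k * m * t := Nat.le_mul_of_pos_right _ ht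
        have h3' : k * m * k ≤ (k * m * t) * (k * m * t) := Nat.mul_le_mul h2' h1'
        nlinarith [h3']
    calc _ ≤ 𝔅.card * (k * m * k + 2) ^ C := h2
      _ ≤ (k * m * t + 2) ^ c * (k * m * k + 2) ^ C := Nat.mul_le_mul_right _ h𝔅card
      _ ≤ (k * m * t + 2) ^ c * ((k * m * t + 2) ^ 2) ^ C :=
        Nat.mul_le_mul_left _ (Nat.pow_le_pow_left hkm C)
      _ = (k * m * t + 2) ^ (2 * C + c) := pow_mul_pow_sq _ _ _

/-! ### The v1 chain, kept for the record -/

/-- A frame with an empty alphabet in some coordinate has no words, hence an empty shadow. -/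
theorem shadow_eq_empty_of_eq_empty (A : Fin m → Finset (Fin 2 →₀ ℕ))
    (f : Fin k → Fin m → MvPolynomial (Fin 2) ℂ) {j : Fin m} (hj : A j = ∅) : shadow A f = ∅ := by
  refine Set.subset_empty_iff.mp fun a ha => ?_
  have h := Fintype.mem_piFinset.mp ha.1 j
  simp [hj] at h

theorem shadow_finite (A : Fin m → Finset (Fin 2 →₀ ℕ)) (f : Fin k → Fin m → MvPolynomial (Fin 2) ℂ) :
    (shadow A f).Finite :=
  (Finset.finite_toSet _).subset (fun _ ha => Finset.mem_coe.mpr ha.1)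

/-- v1 L1: every vertex of the Newton polygon is the point of a shadow word (stubs A + B). -/
theorem extremePoints_subset_shadow (hA : ExposedGenericDirection) (hB : TopSurvivorGreedy)
    {A : Fin m → Finset (Fin 2 →₀ ℕ)} {f : Fin k → Fin m → MvPolynomial (Fin 2) ℂ}
    (hsupp : ∀ i j, (f i j).support ⊆ A j) (hdis : Dissociated A) :
    Set.extremePoints ℝ (convexHull ℝ (emb '' ((∑ i, ∏ j, f i j).support : Set (Fin 2 →₀ ℕ))))
      ⊆ emb '' (pt '' shadow A f) := by
  intro e he
  obtain ⟨w, e₀, he₀, rfl, hmax, hinj⟩ :=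
    hA (∑ i, ∏ j, f i j).support ((Fintype.piFinset A).image pt) _ he
  have hgen : IsGeneric A w := isGeneric_of_injOn hdis hinj
  obtain ⟨a₀, ha₀, hpt, hgr⟩ := hB k m A f w e₀ hsupp hdis he₀ hmax
  exact ⟨pt a₀, ⟨a₀, ⟨ha₀, w, hgen, hgr⟩, rfl⟩, by rw [hpt]⟩

theorem nvert_le_ncard_shadow (hA : ExposedGenericDirection) (hB : TopSurvivorGreedy)
    {A : Fin m → Finset (Fin 2 →₀ ℕ)} {f : Fin k → Fin m → MvPolynomial (Fin 2) ℂ}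
    (hsupp : ∀ i j, (f i j).support ⊆ A j) (hdis : Dissociated A) :
    nvert (∑ i, ∏ j, f i j) ≤ (shadow A f).ncard :=
  calc _ ≤ (emb '' (pt '' shadow A f)).ncard :=
        Set.ncard_le_ncard (extremePoints_subset_shadow hA hB hsupp hdis) (((shadow_finite A f).image pt).image emb)
    _ ≤ (pt '' shadow A f).ncard := Set.ncard_image_le ((shadow_finite A f).image pt)
    _ ≤ (shadow A f).ncard := Set.ncard_image_le (shadow_finite A f)

/-- The v1 open stub implies the v2 open stub (given the true stubs A and B): vertices are shadow words. -/
theorem kLetterFrame_of_kBoxShadowBound (hA : ExposedGenericDirection) (hB : TopSurvivorGreedy)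
    (h : KBoxShadowBound) : KLetterFrame := by
  obtain ⟨C, hC⟩ := h
  refine ⟨C, fun k m A f hcard hsupp hdis => (nvert_le_ncard_shadow hA hB hsupp hdis).trans ?_⟩
  calc (shadow A f).ncard ≤ (k * m + 2) ^ C := hC k m A f hcard hdis
    _ ≤ (k * m * k + 2) ^ C := by
        refine Nat.pow_le_pow_left (Nat.add_le_add_right ?_ 2) C
        rcases Nat.eq_zero_or_pos k with rfl | hk
        · simp
        · exact Nat.le_mul_of_pos_right _ hk

/-- **v1 composition, kept for the record**: stubs A + B + C (all registered) and the v1 open statement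
`KBoxShadowBound` (no longer a registered stub; taken as a hypothesis) give the crux unfolded.  Sorry-free. -/
theorem dissociatedUniform_of_v1 (hA : ExposedGenericDirection) (hB : TopSurvivorGreedy)
    (hC : AlphabetReduction) (hD : KBoxShadowBound) :
    ∃ C : ℕ, ∀ (k m t : ℕ) (A : Fin m → Finset (Fin 2 →₀ ℕ)) (f : Fin k → Fin m → MvPolynomial (Fin 2) ℂ),
      (∀ j, (A j).card ≤ t) → (∀ i j, (f i j).support ⊆ A j) →
      (∀ a b : Fin m → (Fin 2 →₀ ℕ), (∀ j, a j ∈ A j) → (∀ j, b j ∈ A j) → ∑ j, a j = ∑ j, b j → a = b) →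
      (Set.extremePoints ℝ (convexHull ℝ ((fun e : Fin 2 →₀ ℕ => fun i : Fin 2 => ((e i : ℕ) : ℝ)) ''
        ((∑ i, ∏ j, f i j).support : Set (Fin 2 →₀ ℕ))))).ncard ≤ (k * m * t + 2) ^ C := by
  obtain ⟨c, hC⟩ := hC
  obtain ⟨C, hD⟩ := hD
  refine ⟨C + c, fun k m t A f hcard hsupp hinj => ?_⟩
  have hdis : Dissociated A := hinj
  have h1 : nvert (∑ i, ∏ j, f i j) ≤ (shadow A f).ncard := nvert_le_ncard_shadow hA hB hsupp hdis
  have h2 : (shadow A f).ncard ≤ (k * m * t + 2) ^ c * (k * m + 2) ^ C :=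
    hC k m t A f hcard hdis _ fun B hBA hBk => hD k m B f hBk (hdis.mono hBA)
  change nvert (∑ i, ∏ j, f i j) ≤ (k * m * t + 2) ^ (C + c)
  rcases Nat.eq_zero_or_pos t with rfl | ht
  · rcases Nat.eq_zero_or_pos m with rfl | hm
    · calc _ ≤ (shadow A f).ncard := h1
        _ ≤ (k * 0 * 0 + 2) ^ c * (k * 0 + 2) ^ C := h2
        _ = (k * 0 * 0 + 2) ^ (C + c) := by ring
    · have hj : A ⟨0, hm⟩ = ∅ := Finset.card_eq_zero.mp (Nat.le_zero.mp (hcard ⟨0, hm⟩))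
      rw [shadow_eq_empty_of_eq_empty A f hj, Set.ncard_empty] at h1
      exact h1.trans (Nat.zero_le _)
  · calc _ ≤ (shadow A f).ncard := h1
      _ ≤ (k * m * t + 2) ^ c * (k * m + 2) ^ C := h2
      _ ≤ (k * m * t + 2) ^ c * (k * m * t + 2) ^ C :=
        Nat.mul_le_mul_left _
          (Nat.pow_le_pow_left (Nat.add_le_add_right (Nat.le_mul_of_pos_right _ ht) 2) C)
      _ = (k * m * t + 2) ^ (C + c) := by ring

/-- The registered v1 stub C at its readable statement (δ-unfolding check). -/
theorem alphabetReduction_holds : AlphabetReduction := stub_alphabetReduction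

end Glue

/-! ## §4 The skeleton: the crux BY NAME, modulo exactly the registered stubs -/

/-- **Skeleton** (D-0027 §3.3): `NewtonUnitEquations.DissociatedUniform` (stmt-ValiantsHypothesis-5905) from the registered
stubs A, B, B2, C'', D'' (each accepted at the readable statement of §1 by `δ`-unfolding).  The only theorem of this file
whose conclusion is the route decl. -/
theorem DissociatedUniform_of :
    Summit.ValiantsHypothesis.ValiantsHypothesis.Theses.NewtonUnitEquations.DissociatedUniform :=
  dissociatedUniform_of_parts' stub_exposedGenericDirection stub_topSurvivorGreedy stub_coeffFormula
    stub_coveringFamily stub_kLetterFrame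

end Summit.ValiantsHypothesis.ValiantsHypothesis.Cruxes.DissociatedUniform.GreedyBasisShadow

end
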